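import Literature.Computability.QuantumComplexity.RazTalForrelation
import Literature.Computability.Complexity.MultilinearExtension
import HarnessLib

/-!
# `L₁` Fourier tail bounds for low-degree `𝔽₂`-polynomials (CHHL 2018/2019, CHLT 2019)

Named facts (statements only) about the Fourier spectrum of Boolean functions `f = (-1)^{p}`
computed by `𝔽₂`-polynomials `p` of degree `≤ d`, in the tree's vocabulary: `p : MvPolynomial
(Fin m) (ZMod 2)` with `p.totalDegree ≤ d`, read on Boolean points through
`Literature.Computability.Complexity.Multilinear.boolPt`, the Boolean function
`x ↦ decide (eval (boolPt x) p = 1)`, and the level-`k` Fourier `L₁`-mass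
`Literature.Computability.QuantumComplexity.fourierL1Level f k = ∑_{|S|=k} |f̂(S)|` with the
normalised coefficients `f̂(S) = 2^{-m} ∑ₓ sgn(f x) χ_S(x)` (`boolFourierCoeff`, `RazTalForrelation.lean`)
— the `{±1}`-basis convention of both sources. (A non-multilinear `p` is allowed: on Boolean points
it agrees with its multilinear reduction, whose degree is at most `p.totalDegree`.)

* **CHHL, Theorem 6.1** — E. Chattopadhyay, P. Hatami, K. Hosseini, S. Lovett, *Pseudorandom
  generators from polarizing random walks*, CCC 2018 (LIPIcs 102) 1:1–1:21, §6 Thm 6.1 = Theory of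
  Computing 15 (2019) art. 10, Thm 6.1 [ChattopadhyayEtAl2019]: *"Let `p : 𝔽₂ⁿ → 𝔽₂` be a
  polynomial of degree `d`, and let `f(x) = (-1)^{p(x)}`. Then `∑_{|S|=k} |f̂(S)| ≤ (k · 2^{3d})^k`"*
  for all `k = 1, …, n` (held CC-BY text doi:10.4230/LIPIcs.CCC.2018.1, §6 p. 1:19 — materialised
  p0029: statement, "we do not make any assumption on the number of variables `n`", and the proof
  line "Assume towards a contradiction that `W(d,k) > (k2^{3d})^k`"). Fact
  `CHHL2018_fourierL1Level_le`. (For `k > n` the level is empty and the bound trivial, so all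
  `k ≥ 1` are allowed.) The case `k = 2` is the `4 · 2^{6d}` quoted by CHLT.
* **CHLT, Theorem 5** — E. Chattopadhyay, P. Hatami, S. Lovett, A. Tal, *Pseudorandom generators
  from the second Fourier level and applications to AC⁰ with parity gates*, ITCS 2019 (LIPIcs 124)
  22, p. 22:3 [ChattopadhyayHatamiLovettTal2019]: *"`L_{1,1}(Pol_{n,d}) ≤ 4d`"* (held text
  doi:10.4230/LIPIcs.ITCS.2019.22 p. 3). Fact `CHLT2019_fourierL1LevelOne_le`.

NOT here: CHLT's Conjecture 3 (`L_{1,2}(Pol_{n,d}) = O(d²)`, ibid. p. 3 — an open CONJECTURE; it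
is the route item `Summit.QuantumAdvantage.QuantumAdvantage.Theses.ParityFrontier.LevelTwoQuadratic`
and is deliberately not restated as a Literature fact), the PRG consequences (CHLT Thm 2, Claim 4),
the degree-2 sharp bound of Becker–Slote–Volberg–Zhang (arXiv:2412.10842), structured classes
(Błasiok–Ivanov–Jin–Lee–Servedio–Viola 2021). These facts ground
`Summit.QuantumAdvantage.QuantumAdvantage.Theses.ParityFrontier.CHHLLevelK` (item
stmt-QuantumAdvantage-1958 = `CHHL2018_fourierL1Level_le` verbatim) and feed `FoolsLowDegree`
(stmt-QuantumAdvantage-1956, which uses only `k = 2`).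
-/

noncomputable section

namespace Literature.Computability.QuantumComplexity

open Literature.Computability.Complexity

/-- **Chattopadhyay–Hatami–Hosseini–Lovett, Thm 6.1** (CCC 2018 §6 p. 1:19 / ToC 15 (2019)
art. 10): for an `𝔽₂`-polynomial `p` of degree `≤ d` and `f = (-1)^p`, the level-`k` Fourier
`L₁`-mass satisfies `∑_{|S|=k} |f̂(S)| ≤ (k · 2^{3d})^k` for every `k ≥ 1` (any number of
variables). Rendered with `fourierL1Level` (normalised `{±1}`-basis coefficients) and
`MvPolynomial.totalDegree ≤ d` evaluated on Boolean points via `Multilinear.boolPt`.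
Users take `(h : CHHL2018_fourierL1Level_le)`.
[cite: ChattopadhyayEtAl2019, Thm. 6.1 (CCC 2018 version §6, p. 1:19)] -/
def CHHL2018_fourierL1Level_le : Prop :=
  ∀ (m d k : ℕ) (p : MvPolynomial (Fin m) (ZMod 2)), p.totalDegree ≤ d → 1 ≤ k →
    fourierL1Level (fun x : Fin m → Bool => decide (MvPolynomial.eval (Multilinear.boolPt x) p = 1)) k
      ≤ ((k : ℝ) * 2 ^ (3 * d)) ^ k

/-- **Chattopadhyay–Hatami–Lovett–Tal, Thm 5** (ITCS 2019, p. 22:3): the FIRST Fourier level of a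
degree-`≤ d` `𝔽₂`-polynomial has `L₁`-mass at most `4d`: `L_{1,1}(Pol_{n,d}) ≤ 4d`, i.e.
`∑ᵢ |f̂({i})| ≤ 4d` for `f = (-1)^p`. Same rendering as `CHHL2018_fourierL1Level_le`.
Users take `(h : CHLT2019_fourierL1LevelOne_le)`.
[cite: ChattopadhyayHatamiLovettTal2019, Thm. 5 (p. 22:3)] -/
def CHLT2019_fourierL1LevelOne_le : Prop :=
  ∀ (m d : ℕ) (p : MvPolynomial (Fin m) (ZMod 2)), p.totalDegree ≤ d →
    fourierL1Level (fun x : Fin m → Bool => decide (MvPolynomial.eval (Multilinear.boolPt x) p = 1)) 1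
      ≤ 4 * (d : ℝ)

end Literature.Computability.QuantumComplexity

end
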